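import Literature.AnabelianGeometry.EtaleTheta.Discharge.Sec1CyclotomicPackageOfClosure
import HarnessLib

/-!
# [EtTh] §1 p. 12: the commutator pairing identifies the closure of `(Δ^tp_Y)^ell` in `Δ^ell_X` with `Δ_Θ` for
# EVERY datum, and the converse FACT-LIST reduction `DeltaYEllClosureIsoTate ⟸ DeltaThetaIsoTate` (F-1697 ⟸ F-0658)
# — so F-0657 ⟺ F-0658 ⟺ F-1697 in the kernel (proof-only, L3 interface `OncePuncturedTemperedGroup`)

Mochizuki, *The étale theta function and its Frobenioid-theoretic manifestations*, Publ. RIMS **45** (2009)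
[EtTh], §1, PRIMS PDF p. 12 (printed 238): "`1 → Ẑ(1) → Δ^ell_X → Ẑ → 1` … `1 → ∧² Δ^ell_X (≅ Ẑ(1)) → Δ^Θ_X →
Δ^ell_X → 1` … `(Ẑ(1) ≅) Δ_Θ ⊆ Δ^Θ_X`" [cite: MochizukiEtTh2009, §1 p.12]; [IUTchII] Rmk. 1.1.1 (iii) "`[-,-] :
(Δ_X/Δ_Y) × Δ^ell_Y → Δ_Θ`".  abc-iut cell, block C / F = FACT-PROVING WAVE, seat abc-iut-f-172 (gen 2), tranche 172
(F-0658 · F-0659 · F-1697, trunk `SemiGraphs/TemperedCyclotomic.lean` of abc-iut-L3 — read-only consumer, nothing edited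
or restated); PROOF-ONLY (no `def`, no `instance`, no named fact); sequel of `Sec1DeltaThetaIsoTateOfClosure.lean`
(p437928) re-using its public lemmas (`exists_pairingHom`, `pairingHom_conj`, `mk_mem_of_coe_mem_closureDeltaY`,
`coe_mem_closureDeltaY_of_mk_mem`, non-degeneracy and Heisenberg surjectivity of steps 1–2) and abc-iut-L2-t7's
`DeltaEllZHat.exists_deltaEll_hom_zHat` (the canonical `Λ̄ : Δ^ell_X ↠ Ẑ`, whose kernel IS the closure in question).

WHAT IS PROVED, for EVERY `D : OncePuncturedTemperedGroup K` over a field `K : Type` (no origin binder):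
* `OncePuncturedCyclotomic.exists_equivariant_mulEquiv_deltaTheta` — **UNCONDITIONAL STRUCTURE THEOREM**: for any
  closed subgroup `T ≤ Δ^ell_X` whose carrier is the closure of the image of `Δ^tp_Y`, the commutator pairing restricts to
  a multiplicative BIJECTION `e : T ≃* Δ_Θ` which is a homeomorphism (continuous both ways) and `Π^tp_X`-EQUIVARIANT for
  the conjugation actions (`conjDeltaEll`, `conjDeltaThetaX`) — «`Δ_Θ` is the image of `∧² Δ^ell_X`», with its Galois
  action, as a theorem about the typed interface;
* `OncePuncturedCyclotomic.exists_closed_stable_closureDeltaY` — such a `T` exists and is `Π^tp_X`-stable (the kernel of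
  `Λ̄`);
and, for every origin binder `Ω`,
* `OncePuncturedCyclotomic.deltaYEllClosureIsoTate_of_deltaThetaIsoTate` — **F-1697 ⟸ F-0658**: a Tate-twist datum on
  `Δ_Θ` pulls back along `e` to one on `T`;
* `deltaThetaIsoTate_iff_deltaYEllClosureIsoTate`, `deltaThetaIsoTate_iff_deltaEllExtension`,
  `deltaYEllIsoTate_of_deltaThetaIsoTate` — with p437928 / p436437 / p432133 / abc-iut-L2-t7's F-0659 edge:
  **F-0657 ⟺ F-0658 ⟺ F-1697 ⟹ F-0659** in the kernel; the consumers of `DeltaThetaIsoTate` (F-0658: `ThetaCyclotomes`,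
  `CyclotomeGaloisFixedPoints`, `EtaleThetaDataOfSetting*`) thereby hold the whole typed p. 12 package.

HONEST FRAMING: [EtTh] is refereed; the L3 interface is DATA quoting print, asserted for no curve; implications between
OUR typed predicates (their universal closures over the lawless binder are refuted as schemas, abc-iut-w6-d060); nothing
here bears on [IUTchIII] Cor. 3.12; typed ≠ proved; no side is taken on any disputed claim.
-/

noncomputable section

namespace Literature.AnabelianGeometry.EtaleTheta

open Literature.AnabelianGeometry.SemiGraphs
open _root_.Topology
open scoped commutatorElement

namespace OncePuncturedCyclotomic

variable {K : Type} [Field K] (D : OncePuncturedTemperedGroup K)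

/-- **The commutator pairing identifies the closure of `(Δ^tp_Y)^ell` in `Δ^ell_X` with `Δ_Θ`, equivariantly and
homeomorphically, for EVERY datum** ([EtTh] p. 12 «the image of `∧² Δ^ell_X` in `Δ^Θ_X`»; [IUTchII] Rmk. 1.1.1 (iii)):
for a closed `T ≤ Δ^ell_X` whose carrier is the closure of the image of `Δ^tp_Y`, there is `e : T ≃* Δ_Θ` — the
restriction of `ȳ ↦ [ι σ, y]·K₃` (`σ ∈ Δ^tp_X ↦ 1 ∈ Z`) — continuous with continuous inverse and satisfying
`e(g · t) = g · e(t)` for `g ∈ Π^tp_X`. Injective by non-degeneracy, onto by Heisenberg surjectivity (steps 1–2), a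
homeomorphism because `T` is compact and `Δ^Θ_X` Hausdorff. [cite: MochizukiEtTh2009, §1 p.12] -/
theorem exists_equivariant_mulEquiv_deltaTheta (T : Subgroup D.DeltaEll) (hTc : IsClosed (T : Set D.DeltaEll))
    (hTset : (T : Set D.DeltaEll) = closure ((fun δ : D.delta =>
      (QuotientGroup.mk ⟨D.toHat δ, Subgroup.le_topologicalClosure _ ⟨δ, δ.2, rfl⟩⟩ : D.DeltaEll)) ''
        {δ | (δ : D.Pi) ∈ D.piY})) :
    ∃ e : ↥T ≃* ↥D.deltaTheta, Continuous e ∧ Continuous e.symm ∧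
      ∀ (g : D.Pi) (t : ↥T) (ht : D.conjDeltaEll g t ∈ T),
        e ⟨D.conjDeltaEll g t, ht⟩ =
          ⟨D.conjDeltaThetaX g (e t), D.conjDeltaThetaX_mem_deltaTheta g (e t).2⟩ := by
  classical
  haveI : CompactSpace D.PiHat := D.isProfiniteCompletion_toHat.compactSpace
  haveI : T2Space D.PiHat := D.isProfiniteCompletion_toHat.t2Space
  haveI : CompactSpace ↥D.deltaHat := isCompact_iff_compactSpace.mp D.isClosed_deltaHat.isCompact
  haveI : IsClosed ((D.doubleCommutator.subgroupOf D.deltaHat : Subgroup ↥D.deltaHat) : Set ↥D.deltaHat) :=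
    (Subgroup.isClosed_topologicalClosure _).preimage continuous_subtype_val
  haveI : CompactSpace ↥T := isCompact_iff_compactSpace.mp hTc.isCompact
  obtain ⟨σ, hσ, hσZ⟩ := exists_delta_zQuot_eq_one D
  obtain ⟨ψ, hψc, hψΘ, hψmk⟩ := exists_pairingHom D hσ
  let Φ : ↥T →* ↥D.deltaTheta := (ψ.comp T.subtype).codRestrict D.deltaTheta fun t => hψΘ _
  have hΦ : ∀ t : ↥T, (Φ t : D.DeltaThetaX) = ψ (t : D.DeltaEll) := fun t => rfl
  have hΦc : Continuous Φ := Continuous.subtype_mk (hψc.comp continuous_subtype_val) _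
  have hΦinj : Function.Injective Φ := by
    rw [injective_iff_map_eq_one]
    intro t ht
    obtain ⟨y, hy⟩ := QuotientGroup.mk_surjective (t : D.DeltaEll)
    have hyT : (QuotientGroup.mk y : D.DeltaEll) ∈ T := by rw [hy]; exact t.2
    have hyN := coe_mem_closureDeltaY_of_mk_mem D T hTset hyT
    have h1 : ψ (QuotientGroup.mk y) = 1 := by
      rw [hy, ← hΦ, ht, OneMemClass.coe_one]
    rw [hψmk, ← QuotientGroup.mk_one, quotient_mk_eq_iff_coe, OneMemClass.coe_one, QuotientGroup.mk_one,
      QuotientGroup.eq_one_iff] at h1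
    have hyK₂ : (y : D.PiHat) ∈ D.ellKerHat := mem_ellKerHat_of_commutator_mem_doubleCommutator D hσ hσZ hyN h1
    apply Subtype.ext
    rw [← hy, OneMemClass.coe_one, ← QuotientGroup.mk_one, QuotientGroup.eq, mul_one, Subgroup.mem_subgroupOf,
      Subgroup.coe_inv]
    exact D.ellKerHat.inv_mem hyK₂
  have hΦsurj : Function.Surjective Φ := by
    rintro ⟨θ, hθ⟩
    obtain ⟨k, hk, rfl⟩ := hθ
    rw [SetLike.mem_coe, Subgroup.mem_subgroupOf] at hk
    obtain ⟨n, hn, k₃, hk₃, hkeq⟩ := exists_commutator_mul_of_mem_ellKerHat D hσ hσZ hk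
    have hnΔ : n ∈ D.deltaHat := closureDeltaY_le_deltaHat D hn
    have hnT : (QuotientGroup.mk ⟨n, hnΔ⟩ : D.DeltaEll) ∈ T := mk_mem_of_coe_mem_closureDeltaY D T hTc hTset hn
    refine ⟨⟨QuotientGroup.mk ⟨n, hnΔ⟩, hnT⟩, Subtype.ext ?_⟩
    rw [hΦ]
    change ψ (QuotientGroup.mk ⟨n, hnΔ⟩) = QuotientGroup.mk k
    rw [hψmk, quotient_mk_eq_iff_coe, hkeq, QuotientGroup.mk_mul, (QuotientGroup.eq_one_iff k₃).mpr hk₃, mul_one]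
  let e : ↥T ≃* ↥D.deltaTheta := MulEquiv.ofBijective Φ ⟨hΦinj, hΦsurj⟩
  have hec : Continuous e := hΦc
  refine ⟨e, hec, (Continuous.homeoOfEquivCompactToT2 (f := e.toEquiv) hec).symm.continuous, fun g t ht => ?_⟩
  apply Subtype.ext
  change ψ (D.conjDeltaEll g (t : D.DeltaEll)) = D.conjDeltaThetaX g (ψ (t : D.DeltaEll))
  obtain ⟨y, hy⟩ := QuotientGroup.mk_surjective (t : D.DeltaEll)
  have hyT : (QuotientGroup.mk y : D.DeltaEll) ∈ T := by rw [hy]; exact t.2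
  rw [← hy]
  exact pairingHom_conj D hσ ψ hψmk g (coe_mem_closureDeltaY_of_mk_mem D T hTset hyT)

/-- **The closure of the image of `Δ^tp_Y` in `Δ^ell_X` is (the carrier of) a closed `Π^tp_X`-stable subgroup**, namely
the kernel of abc-iut-L2-t7's canonical `Λ̄ : Δ^ell_X ↠ Ẑ` ([EtTh] p. 12, the `Ẑ(1)`-term of the display), for EVERY
datum. [cite: MochizukiEtTh2009, §1 p.12] -/
theorem exists_closed_stable_closureDeltaY :
    ∃ (T : Subgroup D.DeltaEll) (_ : ∀ g, ∀ t ∈ T, D.conjDeltaEll g t ∈ T), IsClosed (T : Set D.DeltaEll) ∧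
      (T : Set D.DeltaEll) = closure ((fun δ : D.delta =>
        (QuotientGroup.mk ⟨D.toHat δ, Subgroup.le_topologicalClosure _ ⟨δ, δ.2, rfl⟩⟩ : D.DeltaEll)) ''
          {δ | (δ : D.Pi) ∈ D.piY}) := by
  obtain ⟨Λ, hΛc, -, hΛconj, hΛker, -⟩ := DeltaEllZHat.exists_deltaEll_hom_zHat D
  refine ⟨Λ.ker, fun g t ht => ?_, ?_, hΛker⟩
  · rw [MonoidHom.mem_ker] at ht ⊢
    rw [hΛconj, ht]
  · have : ((Λ.ker : Subgroup D.DeltaEll) : Set D.DeltaEll) = Λ ⁻¹' {1} := by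
      ext x; simp [MonoidHom.mem_ker]
    rw [this]
    exact isClosed_singleton.preimage hΛc

/-- **FACT-LIST reduction F-1697 ⟸ F-0658** ([EtTh] §1 p. 12): for every origin binder `Ω` over a field `K : Type`, if `Δ_Θ`
with the conjugation action of `Π^tp_X` is a Tate twist `Ẑ(1)` (`DeltaThetaIsoTate Ω`, F-0658), then the closure of the
image of `Δ^tp_Y` in `Δ^ell_X` is a closed `Π^tp_X`-stable Tate twist (`DeltaYEllClosureIsoTate Ω`, F-1697): the level maps
of `Δ_Θ` pull back along the equivariant homeomorphic isomorphism `e : T ≃* Δ_Θ` of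
`exists_equivariant_mulEquiv_deltaTheta`. [cite: MochizukiEtTh2009, §1 p.12] -/
theorem deltaYEllClosureIsoTate_of_deltaThetaIsoTate (Ω : TemperedPiOrigin K)
    (h : OncePuncturedTemperedGroup.DeltaThetaIsoTate Ω) :
    OncePuncturedTemperedGroup.DeltaYEllClosureIsoTate Ω := by
  classical
  intro D hD
  obtain ⟨T, hT, hTc, hTset⟩ := exists_closed_stable_closureDeltaY D
  obtain ⟨e, hec, -, hequiv⟩ := exists_equivariant_mulEquiv_deltaTheta D T hTc hTset
  obtain ⟨ιΘ, h1, h2, h3, h4, h5, h6⟩ := h D hD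
  refine ⟨T, hT, hTc, ?_, hTset⟩
  unfold OncePuncturedTemperedGroup.IsTateTwist
  refine ⟨fun n => (ιΘ n).comp e.toMonoidHom, ?_, ?_, ?_, ?_, ?_, ?_⟩
  · exact fun n hn t => h1 n hn (e t)
  · intro n hn ζ hζ
    obtain ⟨θ, hθ⟩ := h2 n hn ζ hζ
    exact ⟨e.symm θ, by change ιΘ n (e (e.symm θ)) = ζ; rw [MulEquiv.apply_symm_apply, hθ]⟩
  · intro n hn
    have hker : ((((ιΘ n).comp e.toMonoidHom).ker : Subgroup ↥T) : Set ↥T) =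
        e ⁻¹' (((ιΘ n).ker : Subgroup ↥D.deltaTheta) : Set ↥D.deltaTheta) := by
      ext t
      simp only [SetLike.mem_coe, MonoidHom.mem_ker, MonoidHom.coe_comp, Function.comp_apply,
        Set.mem_preimage, MulEquiv.coe_toMonoidHom]
    rw [hker]
    exact (h3 n hn).preimage hec
  · exact fun n m hn hm t => h4 n m hn hm (e t)
  · intro t ht
    have h := h5 (e t) fun n hn => ht n hn
    exact e.injective (h.trans (map_one e).symm)
  · intro n hn g t
    change ((ιΘ n (e ⟨D.conjDeltaEll g t, hT g t t.2⟩) : (AlgebraicClosure K)ˣ) : AlgebraicClosure K) =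
      OncePuncturedTemperedGroup.galApply (D.aug g) ((ιΘ n (e t) : (AlgebraicClosure K)ˣ) : AlgebraicClosure K)
    rw [hequiv g t (hT g t t.2)]
    exact h6 n hn g (e t)

/-- **F-0658 ⟺ F-1697 in the kernel** ([EtTh] §1 p. 12): for every origin binder `Ω` over `K : Type`, the typed
"`Δ_Θ ≅ Ẑ(1)`" and "the closure of the image of `Δ^tp_Y` in `Δ^ell_X` is a `Π^tp_X`-stable Tate twist" are equivalent
(this file and p437928). [cite: MochizukiEtTh2009, §1 p.12] -/
theorem deltaThetaIsoTate_iff_deltaYEllClosureIsoTate (Ω : TemperedPiOrigin K) :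
    OncePuncturedTemperedGroup.DeltaThetaIsoTate Ω ↔ OncePuncturedTemperedGroup.DeltaYEllClosureIsoTate Ω :=
  ⟨deltaYEllClosureIsoTate_of_deltaThetaIsoTate Ω, deltaThetaIsoTate_of_deltaYEllClosureIsoTate Ω⟩

/-- **F-0658 ⟺ F-0657 in the kernel** ([EtTh] §1 p. 12): the typed "`Δ_Θ ≅ Ẑ(1)`" and "`1 → Ẑ(1) → Δ^ell_X → Ẑ → 1`"
are equivalent for every origin binder over `K : Type` (through F-1697: p436437, p432133). [cite: MochizukiEtTh2009, §1 p.12] -/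
theorem deltaThetaIsoTate_iff_deltaEllExtension (Ω : TemperedPiOrigin K) :
    OncePuncturedTemperedGroup.DeltaThetaIsoTate Ω ↔ OncePuncturedTemperedGroup.DeltaEllExtension Ω :=
  (deltaThetaIsoTate_iff_deltaYEllClosureIsoTate Ω).trans (DeltaEllZHat.deltaEllExtension_iff_deltaYEllClosureIsoTate Ω).symm

/-- **F-0659 ⟸ F-0658** ([EtTh] §1 p. 12 "Thus, `(Δ^tp_Y)^ell ≅ Ẑ(1)`"): the typed "`Δ_Θ ≅ Ẑ(1)`" implies the typed
Tate twist of the TEMPERED quotient `(Δ^tp_Y)^ell` (through F-1697 and abc-iut-L2-t7's edge), for every origin binder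
over `K : Type`. [cite: MochizukiEtTh2009, §1 p.12] -/
theorem deltaYEllIsoTate_of_deltaThetaIsoTate (Ω : TemperedPiOrigin K)
    (h : OncePuncturedTemperedGroup.DeltaThetaIsoTate Ω) : OncePuncturedTemperedGroup.DeltaYEllIsoTate Ω :=
  DeltaEllZHat.deltaYEllIsoTate_of_deltaYEllClosureIsoTate Ω (deltaYEllClosureIsoTate_of_deltaThetaIsoTate Ω h)

/-- **The typed [EtTh] p. 12 cyclotomic package from F-0658 alone**: `DeltaThetaIsoTate Ω` implies `DeltaEllExtension Ω`
(F-0657), `DeltaYEllIsoTate Ω` (F-0659) and `DeltaYEllClosureIsoTate Ω` (F-1697), for every origin binder `Ω` over a field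
`K : Type`. [cite: MochizukiEtTh2009, §1 p.12] -/
theorem cyclotomicPackage_of_deltaThetaIsoTate (Ω : TemperedPiOrigin K)
    (h : OncePuncturedTemperedGroup.DeltaThetaIsoTate Ω) :
    OncePuncturedTemperedGroup.DeltaEllExtension Ω ∧ OncePuncturedTemperedGroup.DeltaYEllIsoTate Ω ∧
      OncePuncturedTemperedGroup.DeltaYEllClosureIsoTate Ω :=
  have h' := deltaYEllClosureIsoTate_of_deltaThetaIsoTate Ω h
  ⟨DeltaEllZHat.deltaEllExtension_of_deltaYEllClosureIsoTate Ω h',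
    DeltaEllZHat.deltaYEllIsoTate_of_deltaYEllClosureIsoTate Ω h', h'⟩

end OncePuncturedCyclotomic

end Literature.AnabelianGeometry.EtaleTheta

end
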